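import Summits.QuantumFields.YangMills.Theses.RevelationMartingale
import Summits.QuantumFields.YangMills.Theorems.RevelationMartingaleBondFiltration
import Summits.QuantumFields.YangMills.Theorems.RevelationMartingaleProxyQuadraticVariation
import Summits.QuantumFields.YangMills.Theorems.RevelationMartingaleWindowedCentredMGF
import HarnessLib

/-!
# Route RevelationMartingale — what the deciding crux `SubGaussianRevelationL` (stmt-QuantumFields-23082) and the two
# registered bond-revelation stubs IMPLY, BY NAME: windowed predictable quadratic variation, windowed centred
# sub-Gaussian MGF and windowed second moment at scale `g_(K−j)` (necessary conditions; instrument-row kernel face)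

Cell `ym3-torus` (YM ladder rung R3 = continuum SU(2) Yang–Mills on the three-torus — a RUNG, NOT the Clay problem: not
d = 4, not infinite volume, not a mass gap), width seat `ym-ust-19936-w3` gen 10.  The line-side reading (route cone by
necessity: it imports the route file and the landed bond-filtration file) of the two route-independent engines
`Theorems/RevelationMartingaleProxyQuadraticVariation.lean` (sub-Gaussian conditional MGF for all `s` ⇒ conditional second
moment ≤ proxy) and `Theorems/RevelationMartingaleWindowedCentredMGF.lean` (Stout's supermartingale in expectation form ⇒
windowed centred MGF and second moment), for the registered skeleton `Cruxes/HistoryTailL/Lines/revelation_martingale.lean`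
(v3) on the crux `HistoryTailL` (stmt-QuantumFields-19936).

Write `f = dist1(Ū^j(∂p))`, `μ = gibbsK F ℰp γ K`, `W` = the first-exit window (finer levels `θ(b₀)`-small, level `j`
`θ(b₂)`-small), `g² = γ·L^{−(K−j)}`.  With the SAME constants `γ₁, Cv` and quantifier prefix as the hypothesis:
* `windowedQV_of_subGaussianRevelationL` — 23082 ⇒ `∃ ℱ n` (`ℱ 0 = ⊥`, `f` `ℱ n`-measurable) with
  `Σ_{i<n} E[D_i² | ℱ i] ≤ Cv·g²` a.s. on `W`.
* `windowedMoments_of_subGaussianRevelationL` — 23082 ⇒ the FILTRATION-FREE bounds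
  `∫_W exp(l·(f − ∫ f dμ)) dμ ≤ exp(l²·Cv·g²/2)` for every real `l`, and `∫_W (f − ∫ f dμ)² dμ ≤ e·Cv·g²`.
* `windowedMoments_of_bondRevelationOn` / `…_of_bondRevelation` — the PINNED bond-revelation statement (any depth range
  `A K j → B K j →`; the registered stubs are the ranges `j = 1 → 1 ≤ K →` and `2 ≤ j → j ≤ K →`, their merge
  `bondRevelation_of` the range `1 ≤ j → j ≤ K →`) ⇒ the same filtration-free bounds (the bond-revelation filtration of
  the named enumeration exists: ✓`exists_bondFiltration`; it starts at `⊥` and sees `f` at the horizon `N` since `e` is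
  onto).
USE.  (1) KILL HANDLE for the line card's instrument row («`R_j(K) = Var_W(f)/g²` K-flat»): a PLAIN Monte-Carlo estimate
of `∫_W (f − E f)²/g_(K−j)²` growing without bound in `K` at fixed `(L, b₀, p₀, b₂, γ)` refutes BOTH registered bond
stubs and 23082 (no nested conditional sampling needed).  (2) LOCATED CONTENT: the stubs imply a WINDOWED, GLOBALLY
CENTRED sub-Gaussian exponential moment of `f` at scale `g_(K−j)` for every real `l` — the currency family of the
windowed-MGF lines (cf. `ModerateWindow.WindowMGFL`), here as a CONSEQUENCE of the bond-revelation mechanism.  Necessary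
conditions only: nothing here proves 23082, a stub, `HistoryTailL` or a summit statement. [folklore]
-/

namespace Summit.QuantumFields.YangMills.Theorems.RevelationMartingaleProxyQV

open scoped BigOperators Classical MeasureTheory
open MeasureTheory Literature.MathematicalPhysics.QuantumFieldTheory.Balaban1983to89
  Literature.MathematicalPhysics.QuantumFieldTheory.Balaban1983to89.T3ContinuumYM3Torus
open Summit.QuantumFields.YangMills.Theorems.RevelationMartingaleStout
  (setIntegral_exp_mul_sub_integral_le_of_window setIntegral_sq_sub_integral_le_of_window)

/-- **DECIDING CRUX ⇒ WINDOWED PREDICTABLE QUADRATIC VARIATION (BY NAME).**  The route item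
`Theses.RevelationMartingale.SubGaussianRevelationL` (stmt-QuantumFields-23082) implies: with the same constants
`γ₁, Cv` and the same quantifier prefix, at every `(F, γ, K, j, p)` there are a filtration `ℱ` with `ℱ 0 = ⊥` and a
horizon `n` with `dist1(Ū^j(∂p))` `ℱ n`-measurable such that, a.e. ON THE FIRST-EXIT WINDOW, the predictable
quadratic variation of the Doob martingale of `dist1(Ū^j(∂p))` is `≤ Cv·γ·L^{−(K−j)}` (K-uniform).  A NECESSARY
condition only. [folklore] -/
theorem windowedQV_of_subGaussianRevelationL
    (h : Summit.QuantumFields.YangMills.Theses.RevelationMartingale.SubGaussianRevelationL) :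
    ∀ (L : ℕ) (b₀ p₀ b₂ : ℝ), 0 < b₀ → 2 < p₀ → b₀ ≤ b₂ → ∃ (γ₁ Cv : ℝ), 0 < γ₁ ∧ γ₁ ≤ 1 ∧ 0 < Cv ∧
      ∀ (F : T3Family) (γ : ℝ), F.L = L → 0 < γ → γ ≤ γ₁ → ∀ (K j : ℕ), 1 ≤ j → j ≤ K → ∀ p : Plaq (F.P K) j,
      ∃ (ℱ : MeasureTheory.Filtration ℕ (inferInstance : MeasurableSpace (GaugeField (F.P K) 0 (Matrix.specialUnitaryGroup (Fin 2) ℂ)))) (n : ℕ),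
        ℱ 0 = (⊥ : MeasurableSpace (GaugeField (F.P K) 0 (Matrix.specialUnitaryGroup (Fin 2) ℂ))) ∧
        StronglyMeasurable[ℱ n] (fun U : GaugeField (F.P K) 0 (Matrix.specialUnitaryGroup (Fin 2) ℂ) => GaugeGroup.dist1 (GaugeField.plaqHol
          (Averaging.iter (fun i => BlockAveraging.blockAvg (P := F.P K) (j := i) T3UnitLawDensityEML.ℰp) j U) p)) ∧
        ∀ᵐ U ∂(T3UnitScaleTilt.gibbsK F T3UnitLawDensityEML.ℰp γ K),
          ((∀ k, k < j → PlaqSmall (T3UnitScaleTilt.θBal F.L γ b₀ p₀ (K - k))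
            (Averaging.iter (fun i => BlockAveraging.blockAvg (P := F.P K) (j := i) T3UnitLawDensityEML.ℰp) k U)) ∧
          PlaqSmall (T3UnitScaleTilt.θBal F.L γ b₂ p₀ (K - j))
            (Averaging.iter (fun i => BlockAveraging.blockAvg (P := F.P K) (j := i) T3UnitLawDensityEML.ℰp) j U)) →
          ∑ i ∈ Finset.range n, MeasureTheory.condExp (ℱ i) (T3UnitScaleTilt.gibbsK F T3UnitLawDensityEML.ℰp γ K)
            (fun U' => (MeasureTheory.condExp (ℱ (i + 1)) (T3UnitScaleTilt.gibbsK F T3UnitLawDensityEML.ℰp γ K)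
                  (fun V => GaugeGroup.dist1 (GaugeField.plaqHol
            (Averaging.iter (fun i => BlockAveraging.blockAvg (P := F.P K) (j := i) T3UnitLawDensityEML.ℰp) j V) p)) U' -
               MeasureTheory.condExp (ℱ i) (T3UnitScaleTilt.gibbsK F T3UnitLawDensityEML.ℰp γ K)
                  (fun V => GaugeGroup.dist1 (GaugeField.plaqHol
            (Averaging.iter (fun i => BlockAveraging.blockAvg (P := F.P K) (j := i) T3UnitLawDensityEML.ℰp) j V) p)) U') ^ 2) U
            ≤ Cv * (γ * ((F.L : ℝ)⁻¹) ^ (K - j)) := by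
  intro L b₀ p₀ b₂ hb₀ hp₀ hb₂
  obtain ⟨γ₁, Cv, hγ₁, hγ₁1, hCv, hF⟩ := h L b₀ p₀ b₂ hb₀ hp₀ hb₂
  refine ⟨γ₁, Cv, hγ₁, hγ₁1, hCv, fun F γ hL hγ hγle K j hj hjK p => ?_⟩
  obtain ⟨ℱ, n, σ, h0, hn, _hσm, _hσ0, hmgf, hwin⟩ := hF F γ hL hγ hγle K j hj hjK p
  exact ⟨ℱ, n, h0, hn, windowedQV_gibbsK F hγ.le K j p ℱ hmgf hwin⟩

/-- The proxy budget `Cv·γ·L^{−(K−j)}` is positive (`Cv > 0`, `γ > 0`, `L > 1`). [folklore] -/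
theorem proxyBudget_pos (F : T3Family) {γ Cv : ℝ} (hγ : 0 < γ) (hCv : 0 < Cv) (K j : ℕ) :
    0 < Cv * (γ * ((F.L : ℝ)⁻¹) ^ (K - j)) := by
  have hL : (0 : ℝ) < F.L := by exact_mod_cast lt_trans zero_lt_one F.hL.2
  positivity

/-- **ONE CUT-OFF, ONE FILTRATION ⇒ WINDOWED MOMENTS.**  At fixed `(F, γ, K, j, p)`: a filtration `ℱ` with `ℱ 0 = ⊥` that
sees `dist1(Ū^j(∂p))` at the horizon `n`, adapted proxies `σ i ≥ 0` with the rows for every real `s`, and a proxy budget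
`v > 0` on an event `W` give the windowed centred MGF bound at every real `l` and the windowed second moment `≤ e·v`.
[folklore] -/
theorem windowedMoments_gibbsK (F : T3Family) {γ : ℝ} (hγ : 0 ≤ γ) (K j : ℕ) (p : Plaq (F.P K) j)
    (ℱ : MeasureTheory.Filtration ℕ (inferInstance : MeasurableSpace (GaugeField (F.P K) 0 (Matrix.specialUnitaryGroup (Fin 2) ℂ))))
    (h0 : ℱ 0 = (⊥ : MeasurableSpace (GaugeField (F.P K) 0 (Matrix.specialUnitaryGroup (Fin 2) ℂ)))) {n : ℕ}
    (hn : StronglyMeasurable[ℱ n] (fun U : GaugeField (F.P K) 0 (Matrix.specialUnitaryGroup (Fin 2) ℂ) => GaugeGroup.dist1 (GaugeField.plaqHol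
          (Averaging.iter (fun i => BlockAveraging.blockAvg (P := F.P K) (j := i) T3UnitLawDensityEML.ℰp) j U) p)))
    {σ : ℕ → GaugeField (F.P K) 0 (Matrix.specialUnitaryGroup (Fin 2) ℂ) → ℝ} (hσm : ∀ i, StronglyMeasurable[ℱ i] (σ i)) (hσ0 : ∀ i U, 0 ≤ σ i U)
    (hmgf : (∀ (i : ℕ) (s : ℝ), ∀ᵐ U ∂(T3UnitScaleTilt.gibbsK F T3UnitLawDensityEML.ℰp γ K),
          MeasureTheory.condExp (ℱ i) (T3UnitScaleTilt.gibbsK F T3UnitLawDensityEML.ℰp γ K)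
            (fun U' => Real.exp (s *
              (MeasureTheory.condExp (ℱ (i + 1)) (T3UnitScaleTilt.gibbsK F T3UnitLawDensityEML.ℰp γ K)
                  (fun V => GaugeGroup.dist1 (GaugeField.plaqHol
            (Averaging.iter (fun i => BlockAveraging.blockAvg (P := F.P K) (j := i) T3UnitLawDensityEML.ℰp) j V) p)) U' -
               MeasureTheory.condExp (ℱ i) (T3UnitScaleTilt.gibbsK F T3UnitLawDensityEML.ℰp γ K)
                  (fun V => GaugeGroup.dist1 (GaugeField.plaqHol
            (Averaging.iter (fun i => BlockAveraging.blockAvg (P := F.P K) (j := i) T3UnitLawDensityEML.ℰp) j V) p)) U'))) U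
            ≤ Real.exp (s ^ 2 * σ i U / 2)))
    {W : Set (GaugeField (F.P K) 0 (Matrix.specialUnitaryGroup (Fin 2) ℂ))} {v : ℝ} (hv : 0 < v)
    (hwin : ∀ᵐ U ∂(T3UnitScaleTilt.gibbsK F T3UnitLawDensityEML.ℰp γ K), U ∈ W → ∑ i ∈ Finset.range n, σ i U ≤ v) :
    (∀ l : ℝ, ∫ U in W, Real.exp (l * (GaugeGroup.dist1 (GaugeField.plaqHol
              (Averaging.iter (fun i => BlockAveraging.blockAvg (P := F.P K) (j := i) T3UnitLawDensityEML.ℰp) j U) p) -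
            ∫ X, GaugeGroup.dist1 (GaugeField.plaqHol
              (Averaging.iter (fun i => BlockAveraging.blockAvg (P := F.P K) (j := i) T3UnitLawDensityEML.ℰp) j X) p) ∂(T3UnitScaleTilt.gibbsK F T3UnitLawDensityEML.ℰp γ K))) ∂(T3UnitScaleTilt.gibbsK F T3UnitLawDensityEML.ℰp γ K)
          ≤ Real.exp (l ^ 2 * v / 2)) ∧
      ∫ U in W, (GaugeGroup.dist1 (GaugeField.plaqHol
              (Averaging.iter (fun i => BlockAveraging.blockAvg (P := F.P K) (j := i) T3UnitLawDensityEML.ℰp) j U) p) -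
            ∫ X, GaugeGroup.dist1 (GaugeField.plaqHol
              (Averaging.iter (fun i => BlockAveraging.blockAvg (P := F.P K) (j := i) T3UnitLawDensityEML.ℰp) j X) p) ∂(T3UnitScaleTilt.gibbsK F T3UnitLawDensityEML.ℰp γ K)) ^ 2 ∂(T3UnitScaleTilt.gibbsK F T3UnitLawDensityEML.ℰp γ K)
          ≤ Real.exp 1 * v := by
  haveI := T3UnitScaleTilt.isProbabilityMeasure_gibbsK F T3UnitLawDensityEML.ℰp hγ K
  exact ⟨fun l => setIntegral_exp_mul_sub_integral_le_of_window ℱ (abs_dist1_iter_plaqHol_le_two F K j p) h0 hn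
      hσm hσ0 l (fun i => hmgf i l) hwin,
    setIntegral_sq_sub_integral_le_of_window ℱ (abs_dist1_iter_plaqHol_le_two F K j p) h0 hn hσm hσ0 hmgf hv hwin⟩

/-- **DECIDING CRUX ⇒ WINDOWED CENTRED SUB-GAUSSIAN MGF AND WINDOWED SECOND MOMENT (BY NAME, filtration-free).**
`Theses.RevelationMartingale.SubGaussianRevelationL` implies: with the same `γ₁, Cv` and prefix, at every
`(F, γ, K, j, p)`, for every real `l`, `∫_W exp(l·(f − ∫ f dμ)) dμ ≤ exp(l²·Cv·g²/2)` and `∫_W (f − ∫ f dμ)² dμ ≤ e·Cv·g²`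
(`f = dist1(Ū^j(∂p))`, `μ = gibbsK`, `W` the first-exit window, `g² = γ·L^{−(K−j)}`).  NECESSARY conditions only; the
second is testable by plain Monte Carlo. [folklore] -/
theorem windowedMoments_of_subGaussianRevelationL
    (h : Summit.QuantumFields.YangMills.Theses.RevelationMartingale.SubGaussianRevelationL) :
    ∀ (L : ℕ) (b₀ p₀ b₂ : ℝ), 0 < b₀ → 2 < p₀ → b₀ ≤ b₂ → ∃ (γ₁ Cv : ℝ), 0 < γ₁ ∧ γ₁ ≤ 1 ∧ 0 < Cv ∧
      ∀ (F : T3Family) (γ : ℝ), F.L = L → 0 < γ → γ ≤ γ₁ → ∀ (K j : ℕ), 1 ≤ j → j ≤ K → ∀ p : Plaq (F.P K) j,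
      (∀ l : ℝ, ∫ U in {U : GaugeField (F.P K) 0 (Matrix.specialUnitaryGroup (Fin 2) ℂ) |
          ((∀ k, k < j → PlaqSmall (T3UnitScaleTilt.θBal F.L γ b₀ p₀ (K - k))
            (Averaging.iter (fun i => BlockAveraging.blockAvg (P := F.P K) (j := i) T3UnitLawDensityEML.ℰp) k U)) ∧
          PlaqSmall (T3UnitScaleTilt.θBal F.L γ b₂ p₀ (K - j))
            (Averaging.iter (fun i => BlockAveraging.blockAvg (P := F.P K) (j := i) T3UnitLawDensityEML.ℰp) j U))}, Real.exp (l * (GaugeGroup.dist1 (GaugeField.plaqHol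
              (Averaging.iter (fun i => BlockAveraging.blockAvg (P := F.P K) (j := i) T3UnitLawDensityEML.ℰp) j U) p) -
            ∫ X, GaugeGroup.dist1 (GaugeField.plaqHol
              (Averaging.iter (fun i => BlockAveraging.blockAvg (P := F.P K) (j := i) T3UnitLawDensityEML.ℰp) j X) p) ∂(T3UnitScaleTilt.gibbsK F T3UnitLawDensityEML.ℰp γ K))) ∂(T3UnitScaleTilt.gibbsK F T3UnitLawDensityEML.ℰp γ K)
          ≤ Real.exp (l ^ 2 * (Cv * (γ * ((F.L : ℝ)⁻¹) ^ (K - j))) / 2)) ∧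
      ∫ U in {U : GaugeField (F.P K) 0 (Matrix.specialUnitaryGroup (Fin 2) ℂ) |
          ((∀ k, k < j → PlaqSmall (T3UnitScaleTilt.θBal F.L γ b₀ p₀ (K - k))
            (Averaging.iter (fun i => BlockAveraging.blockAvg (P := F.P K) (j := i) T3UnitLawDensityEML.ℰp) k U)) ∧
          PlaqSmall (T3UnitScaleTilt.θBal F.L γ b₂ p₀ (K - j))
            (Averaging.iter (fun i => BlockAveraging.blockAvg (P := F.P K) (j := i) T3UnitLawDensityEML.ℰp) j U))}, (GaugeGroup.dist1 (GaugeField.plaqHol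
              (Averaging.iter (fun i => BlockAveraging.blockAvg (P := F.P K) (j := i) T3UnitLawDensityEML.ℰp) j U) p) -
            ∫ X, GaugeGroup.dist1 (GaugeField.plaqHol
              (Averaging.iter (fun i => BlockAveraging.blockAvg (P := F.P K) (j := i) T3UnitLawDensityEML.ℰp) j X) p) ∂(T3UnitScaleTilt.gibbsK F T3UnitLawDensityEML.ℰp γ K)) ^ 2 ∂(T3UnitScaleTilt.gibbsK F T3UnitLawDensityEML.ℰp γ K)
          ≤ Real.exp 1 * (Cv * (γ * ((F.L : ℝ)⁻¹) ^ (K - j))) := by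
  intro L b₀ p₀ b₂ hb₀ hp₀ hb₂
  obtain ⟨γ₁, Cv, hγ₁, hγ₁1, hCv, hF⟩ := h L b₀ p₀ b₂ hb₀ hp₀ hb₂
  refine ⟨γ₁, Cv, hγ₁, hγ₁1, hCv, fun F γ hL hγ hγle K j hj hjK p => ?_⟩
  obtain ⟨ℱ, n, σ, h0, hn, hσm, hσ0, hmgf, hwin⟩ := hF F γ hL hγ hγle K j hj hjK p
  exact windowedMoments_gibbsK F hγ.le K j p ℱ h0 hn hσm hσ0 hmgf (proxyBudget_pos F hγ hCv K j)
    (by filter_upwards [hwin] with U hU hW; exact hU hW)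

/-- **PINNED BOND REVELATION ⇒ WINDOWED MOMENTS (any depth range, filtration-free conclusion).**  For an arbitrary depth
side-condition `A K j → B K j →` (registered stubs: `j = 1 → 1 ≤ K →` and `2 ≤ j → j ≤ K →`): the pinned
bond-revelation statement on that range implies, with the same `γ₁, Cv` and prefix, the windowed centred MGF bound at
every real `l` and `∫_W (f − ∫ f dμ)² dμ ≤ e·Cv·γ·L^{−(K−j)}`.  The bond-revelation filtration of the named enumeration
`e` exists (✓`exists_bondFiltration`), starts at `⊥` (✓`bondReveal_comap_zero`) and sees `f` at the horizon `N`
(✓`measurable_bondReveal_comap_top`, `e` onto). NECESSARY conditions only. [folklore] -/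
theorem windowedMoments_of_bondRevelationOn (A B : ℕ → ℕ → Prop)
    (h : ∀ (L : ℕ) (b₀ p₀ b₂ : ℝ), 0 < b₀ → 2 < p₀ → b₀ ≤ b₂ → ∃ (γ₁ Cv : ℝ), 0 < γ₁ ∧ γ₁ ≤ 1 ∧ 0 < Cv ∧
      ∀ (F : T3Family) (γ : ℝ), F.L = L → 0 < γ → γ ≤ γ₁ → ∀ (K j : ℕ), A K j → B K j → ∀ p : Plaq (F.P K) j,
      ∃ (N : ℕ) (e : Fin N → PBond (F.P K) 0), Function.Surjective e ∧
        ∀ ℱ : MeasureTheory.Filtration ℕ (inferInstance : MeasurableSpace (GaugeField (F.P K) 0 (Matrix.specialUnitaryGroup (Fin 2) ℂ))),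
          (∀ i, ℱ i = MeasurableSpace.comap
          (fun (U : GaugeField (F.P K) 0 (Matrix.specialUnitaryGroup (Fin 2) ℂ)) (m : Fin N) =>
            if (m : ℕ) < i then U (e m) else (1 : Matrix.specialUnitaryGroup (Fin 2) ℂ)) inferInstance) →
        ∃ σ : ℕ → GaugeField (F.P K) 0 (Matrix.specialUnitaryGroup (Fin 2) ℂ) → ℝ,
          (∀ i, StronglyMeasurable[ℱ i] (σ i)) ∧
          (∀ i U, 0 ≤ σ i U) ∧
          (∀ (i : ℕ) (s : ℝ), ∀ᵐ U ∂(T3UnitScaleTilt.gibbsK F T3UnitLawDensityEML.ℰp γ K),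
          MeasureTheory.condExp (ℱ i) (T3UnitScaleTilt.gibbsK F T3UnitLawDensityEML.ℰp γ K)
            (fun U' => Real.exp (s *
              (MeasureTheory.condExp (ℱ (i + 1)) (T3UnitScaleTilt.gibbsK F T3UnitLawDensityEML.ℰp γ K)
                  (fun V => GaugeGroup.dist1 (GaugeField.plaqHol
            (Averaging.iter (fun i => BlockAveraging.blockAvg (P := F.P K) (j := i) T3UnitLawDensityEML.ℰp) j V) p)) U' -
               MeasureTheory.condExp (ℱ i) (T3UnitScaleTilt.gibbsK F T3UnitLawDensityEML.ℰp γ K)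
                  (fun V => GaugeGroup.dist1 (GaugeField.plaqHol
            (Averaging.iter (fun i => BlockAveraging.blockAvg (P := F.P K) (j := i) T3UnitLawDensityEML.ℰp) j V) p)) U'))) U
            ≤ Real.exp (s ^ 2 * σ i U / 2)) ∧
          (∀ᵐ U ∂(T3UnitScaleTilt.gibbsK F T3UnitLawDensityEML.ℰp γ K),
            ((∀ k, k < j → PlaqSmall (T3UnitScaleTilt.θBal F.L γ b₀ p₀ (K - k))
            (Averaging.iter (fun i => BlockAveraging.blockAvg (P := F.P K) (j := i) T3UnitLawDensityEML.ℰp) k U)) ∧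
          PlaqSmall (T3UnitScaleTilt.θBal F.L γ b₂ p₀ (K - j))
            (Averaging.iter (fun i => BlockAveraging.blockAvg (P := F.P K) (j := i) T3UnitLawDensityEML.ℰp) j U)) →
            ∑ i ∈ Finset.range N, σ i U ≤ Cv * (γ * ((F.L : ℝ)⁻¹) ^ (K - j)))) :
    ∀ (L : ℕ) (b₀ p₀ b₂ : ℝ), 0 < b₀ → 2 < p₀ → b₀ ≤ b₂ → ∃ (γ₁ Cv : ℝ), 0 < γ₁ ∧ γ₁ ≤ 1 ∧ 0 < Cv ∧
      ∀ (F : T3Family) (γ : ℝ), F.L = L → 0 < γ → γ ≤ γ₁ → ∀ (K j : ℕ), A K j → B K j → ∀ p : Plaq (F.P K) j,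
      (∀ l : ℝ, ∫ U in {U : GaugeField (F.P K) 0 (Matrix.specialUnitaryGroup (Fin 2) ℂ) |
          ((∀ k, k < j → PlaqSmall (T3UnitScaleTilt.θBal F.L γ b₀ p₀ (K - k))
            (Averaging.iter (fun i => BlockAveraging.blockAvg (P := F.P K) (j := i) T3UnitLawDensityEML.ℰp) k U)) ∧
          PlaqSmall (T3UnitScaleTilt.θBal F.L γ b₂ p₀ (K - j))
            (Averaging.iter (fun i => BlockAveraging.blockAvg (P := F.P K) (j := i) T3UnitLawDensityEML.ℰp) j U))}, Real.exp (l * (GaugeGroup.dist1 (GaugeField.plaqHol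
              (Averaging.iter (fun i => BlockAveraging.blockAvg (P := F.P K) (j := i) T3UnitLawDensityEML.ℰp) j U) p) -
            ∫ X, GaugeGroup.dist1 (GaugeField.plaqHol
              (Averaging.iter (fun i => BlockAveraging.blockAvg (P := F.P K) (j := i) T3UnitLawDensityEML.ℰp) j X) p) ∂(T3UnitScaleTilt.gibbsK F T3UnitLawDensityEML.ℰp γ K))) ∂(T3UnitScaleTilt.gibbsK F T3UnitLawDensityEML.ℰp γ K)
          ≤ Real.exp (l ^ 2 * (Cv * (γ * ((F.L : ℝ)⁻¹) ^ (K - j))) / 2)) ∧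
      ∫ U in {U : GaugeField (F.P K) 0 (Matrix.specialUnitaryGroup (Fin 2) ℂ) |
          ((∀ k, k < j → PlaqSmall (T3UnitScaleTilt.θBal F.L γ b₀ p₀ (K - k))
            (Averaging.iter (fun i => BlockAveraging.blockAvg (P := F.P K) (j := i) T3UnitLawDensityEML.ℰp) k U)) ∧
          PlaqSmall (T3UnitScaleTilt.θBal F.L γ b₂ p₀ (K - j))
            (Averaging.iter (fun i => BlockAveraging.blockAvg (P := F.P K) (j := i) T3UnitLawDensityEML.ℰp) j U))}, (GaugeGroup.dist1 (GaugeField.plaqHol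
              (Averaging.iter (fun i => BlockAveraging.blockAvg (P := F.P K) (j := i) T3UnitLawDensityEML.ℰp) j U) p) -
            ∫ X, GaugeGroup.dist1 (GaugeField.plaqHol
              (Averaging.iter (fun i => BlockAveraging.blockAvg (P := F.P K) (j := i) T3UnitLawDensityEML.ℰp) j X) p) ∂(T3UnitScaleTilt.gibbsK F T3UnitLawDensityEML.ℰp γ K)) ^ 2 ∂(T3UnitScaleTilt.gibbsK F T3UnitLawDensityEML.ℰp γ K)
          ≤ Real.exp 1 * (Cv * (γ * ((F.L : ℝ)⁻¹) ^ (K - j))) := by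
  intro L b₀ p₀ b₂ hb₀ hp₀ hb₂
  obtain ⟨γ₁, Cv, hγ₁, hγ₁1, hCv, hF⟩ := h L b₀ p₀ b₂ hb₀ hp₀ hb₂
  refine ⟨γ₁, Cv, hγ₁, hγ₁1, hCv, fun F γ hL hγ hγle K j hA hB p => ?_⟩
  obtain ⟨N, e, he, hAll⟩ := hF F γ hL hγ hγle K j hA hB p
  obtain ⟨ℱ, hℱ⟩ := exists_bondFiltration (G := Matrix.specialUnitaryGroup (Fin 2) ℂ) e
  obtain ⟨σ, hσm, hσ0, hmgf, hwin⟩ := hAll ℱ hℱ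
  have h0 : ℱ 0 = (⊥ : MeasurableSpace (GaugeField (F.P K) 0 (Matrix.specialUnitaryGroup (Fin 2) ℂ))) := by
    rw [hℱ 0]; exact bondReveal_comap_zero e
  have hN : StronglyMeasurable[ℱ N] (fun U : GaugeField (F.P K) 0 (Matrix.specialUnitaryGroup (Fin 2) ℂ) =>
      GaugeGroup.dist1 (GaugeField.plaqHol
        (Averaging.iter (fun i => BlockAveraging.blockAvg (P := F.P K) (j := i) T3UnitLawDensityEML.ℰp) j U) p)) := by
    have hm := measurable_bondReveal_comap_top e he (measurable_dist1_iter_plaqHol F K j p)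
    rw [← hℱ N] at hm
    exact hm.stronglyMeasurable
  exact windowedMoments_gibbsK F hγ.le K j p ℱ h0 hN hσm hσ0 hmgf (proxyBudget_pos F hγ hCv K j)
    (by filter_upwards [hwin] with U hU hW; exact hU hW)

/-- The same on the merged depth range `1 ≤ j ≤ K` (hypothesis VERBATIM the hypothesis of the landed
`revelationMartingale_subGaussianRevelationL_of_bondRevelation` = the conclusion of the skeleton's `bondRevelation_of`).
[folklore] -/
theorem windowedMoments_of_bondRevelation
    (h : ∀ (L : ℕ) (b₀ p₀ b₂ : ℝ), 0 < b₀ → 2 < p₀ → b₀ ≤ b₂ → ∃ (γ₁ Cv : ℝ), 0 < γ₁ ∧ γ₁ ≤ 1 ∧ 0 < Cv ∧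
      ∀ (F : T3Family) (γ : ℝ), F.L = L → 0 < γ → γ ≤ γ₁ → ∀ (K j : ℕ), 1 ≤ j → j ≤ K → ∀ p : Plaq (F.P K) j,
      ∃ (N : ℕ) (e : Fin N → PBond (F.P K) 0), Function.Surjective e ∧
        ∀ ℱ : MeasureTheory.Filtration ℕ (inferInstance : MeasurableSpace (GaugeField (F.P K) 0 (Matrix.specialUnitaryGroup (Fin 2) ℂ))),
          (∀ i, ℱ i = MeasurableSpace.comap
          (fun (U : GaugeField (F.P K) 0 (Matrix.specialUnitaryGroup (Fin 2) ℂ)) (m : Fin N) =>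
            if (m : ℕ) < i then U (e m) else (1 : Matrix.specialUnitaryGroup (Fin 2) ℂ)) inferInstance) →
        ∃ σ : ℕ → GaugeField (F.P K) 0 (Matrix.specialUnitaryGroup (Fin 2) ℂ) → ℝ,
          (∀ i, StronglyMeasurable[ℱ i] (σ i)) ∧
          (∀ i U, 0 ≤ σ i U) ∧
          (∀ (i : ℕ) (s : ℝ), ∀ᵐ U ∂(T3UnitScaleTilt.gibbsK F T3UnitLawDensityEML.ℰp γ K),
          MeasureTheory.condExp (ℱ i) (T3UnitScaleTilt.gibbsK F T3UnitLawDensityEML.ℰp γ K)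
            (fun U' => Real.exp (s *
              (MeasureTheory.condExp (ℱ (i + 1)) (T3UnitScaleTilt.gibbsK F T3UnitLawDensityEML.ℰp γ K)
                  (fun V => GaugeGroup.dist1 (GaugeField.plaqHol
            (Averaging.iter (fun i => BlockAveraging.blockAvg (P := F.P K) (j := i) T3UnitLawDensityEML.ℰp) j V) p)) U' -
               MeasureTheory.condExp (ℱ i) (T3UnitScaleTilt.gibbsK F T3UnitLawDensityEML.ℰp γ K)
                  (fun V => GaugeGroup.dist1 (GaugeField.plaqHol
            (Averaging.iter (fun i => BlockAveraging.blockAvg (P := F.P K) (j := i) T3UnitLawDensityEML.ℰp) j V) p)) U'))) U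
            ≤ Real.exp (s ^ 2 * σ i U / 2)) ∧
          (∀ᵐ U ∂(T3UnitScaleTilt.gibbsK F T3UnitLawDensityEML.ℰp γ K),
            ((∀ k, k < j → PlaqSmall (T3UnitScaleTilt.θBal F.L γ b₀ p₀ (K - k))
            (Averaging.iter (fun i => BlockAveraging.blockAvg (P := F.P K) (j := i) T3UnitLawDensityEML.ℰp) k U)) ∧
          PlaqSmall (T3UnitScaleTilt.θBal F.L γ b₂ p₀ (K - j))
            (Averaging.iter (fun i => BlockAveraging.blockAvg (P := F.P K) (j := i) T3UnitLawDensityEML.ℰp) j U)) →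
            ∑ i ∈ Finset.range N, σ i U ≤ Cv * (γ * ((F.L : ℝ)⁻¹) ^ (K - j)))) :
    ∀ (L : ℕ) (b₀ p₀ b₂ : ℝ), 0 < b₀ → 2 < p₀ → b₀ ≤ b₂ → ∃ (γ₁ Cv : ℝ), 0 < γ₁ ∧ γ₁ ≤ 1 ∧ 0 < Cv ∧
      ∀ (F : T3Family) (γ : ℝ), F.L = L → 0 < γ → γ ≤ γ₁ → ∀ (K j : ℕ), 1 ≤ j → j ≤ K → ∀ p : Plaq (F.P K) j,
      (∀ l : ℝ, ∫ U in {U : GaugeField (F.P K) 0 (Matrix.specialUnitaryGroup (Fin 2) ℂ) |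
          ((∀ k, k < j → PlaqSmall (T3UnitScaleTilt.θBal F.L γ b₀ p₀ (K - k))
            (Averaging.iter (fun i => BlockAveraging.blockAvg (P := F.P K) (j := i) T3UnitLawDensityEML.ℰp) k U)) ∧
          PlaqSmall (T3UnitScaleTilt.θBal F.L γ b₂ p₀ (K - j))
            (Averaging.iter (fun i => BlockAveraging.blockAvg (P := F.P K) (j := i) T3UnitLawDensityEML.ℰp) j U))}, Real.exp (l * (GaugeGroup.dist1 (GaugeField.plaqHol
              (Averaging.iter (fun i => BlockAveraging.blockAvg (P := F.P K) (j := i) T3UnitLawDensityEML.ℰp) j U) p) -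
            ∫ X, GaugeGroup.dist1 (GaugeField.plaqHol
              (Averaging.iter (fun i => BlockAveraging.blockAvg (P := F.P K) (j := i) T3UnitLawDensityEML.ℰp) j X) p) ∂(T3UnitScaleTilt.gibbsK F T3UnitLawDensityEML.ℰp γ K))) ∂(T3UnitScaleTilt.gibbsK F T3UnitLawDensityEML.ℰp γ K)
          ≤ Real.exp (l ^ 2 * (Cv * (γ * ((F.L : ℝ)⁻¹) ^ (K - j))) / 2)) ∧
      ∫ U in {U : GaugeField (F.P K) 0 (Matrix.specialUnitaryGroup (Fin 2) ℂ) |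
          ((∀ k, k < j → PlaqSmall (T3UnitScaleTilt.θBal F.L γ b₀ p₀ (K - k))
            (Averaging.iter (fun i => BlockAveraging.blockAvg (P := F.P K) (j := i) T3UnitLawDensityEML.ℰp) k U)) ∧
          PlaqSmall (T3UnitScaleTilt.θBal F.L γ b₂ p₀ (K - j))
            (Averaging.iter (fun i => BlockAveraging.blockAvg (P := F.P K) (j := i) T3UnitLawDensityEML.ℰp) j U))}, (GaugeGroup.dist1 (GaugeField.plaqHol
              (Averaging.iter (fun i => BlockAveraging.blockAvg (P := F.P K) (j := i) T3UnitLawDensityEML.ℰp) j U) p) -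
            ∫ X, GaugeGroup.dist1 (GaugeField.plaqHol
              (Averaging.iter (fun i => BlockAveraging.blockAvg (P := F.P K) (j := i) T3UnitLawDensityEML.ℰp) j X) p) ∂(T3UnitScaleTilt.gibbsK F T3UnitLawDensityEML.ℰp γ K)) ^ 2 ∂(T3UnitScaleTilt.gibbsK F T3UnitLawDensityEML.ℰp γ K)
          ≤ Real.exp 1 * (Cv * (γ * ((F.L : ℝ)⁻¹) ^ (K - j))) :=
  windowedMoments_of_bondRevelationOn (fun _ j => 1 ≤ j) (fun K j => j ≤ K) h

end Summit.QuantumFields.YangMills.Theorems.RevelationMartingaleProxyQV
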